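import Summits.QuantumFields.YangMills.Theorems.BalabanUVNodesN11PerBondInverseLawsOfRecordAC
import Literature.MeasureTheory.Function.MeasurableInvFunOn

/-!
# DAG node N11 — THE COMPLETE PER-BOND INVERSION BUNDLE OF THE AVERAGING OF RECORD FROM INJECTIVITY WINDOWS ALONE: Lusin–Souslin (the inverse) + kernel Radon–Nikodym
# (the law) — no forward Jacobian law, no exponential chart; and the (B4) chart half at `fieldMeasure` modulo injectivity windows + support clause only

HEADER — WORK-UNIT METADATA.  Cell `pub-ymgap`, YM-PLAN Track A (HUMAN RULING D-0062 ∕ D-0149 ∕ D-0154 (3a)), WIDTH SEAT `pub-ymgap-dag-n11-w6` (g2) on node N11 [B14];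
route `BalabanUVNodes`, key item K1⁷ `StabilityBAtRecordR13SepCoPH` = stmt-QuantumFields-20542 (helper lane, `--kind proof --supports 20542 --as helper`, count-neutral).
[I] = [Balaban1987RG1], [III] = [Balaban1988Convergent].  Bus: CLAIM-4 = INTENT-4 of this seat (R455 (A)).  Over this seat's file 2 `…N11PerBondInverseLawsOfRecordAC` (p622229:
the inverse LAW from absolute continuity — `exists_perBondInverseLaws_of_inverses`) and file 1 `…N11TransportOfRecordInPrivateCoordinateChart` (p620673: the socket ∕ transport at
`fieldMeasure` from per-bond data), and dag-n09-w6 g3's `Lit/MeasureTheory/Function/MeasurableInvFunOn` (p622580: ★★ `exists_measurable_fibrewiseInverse` — ONE jointly measurable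
fibrewise inverse from injectivity windows by Lusin–Souslin, [Kechris1995] Thm 15.1).

WHY THIS FILE.  dag-n09-w6 g3's `…N09PerBondChartsOfInjectivityWindows.exists_perBondCharts_of_injectivityWindows` (their INTENT-5) builds the per-bond bundle
`(T, ϑ, jd; hTm, hθm, hjm, hright, hlaw)` of `T4TriangularFibredChart` from an injectivity window PLUS a forward Jacobian law `(jac, hjacm, hjac0, hfwd)` — the located (F)
«C¹-in-exponential-chart».  With file 2 the law needs no Jacobian: THIS FILE produces the SAME bundle (and the same two-sided inverse facts) from the injectivity windows ALONE —
`(Ω; hΩm, hinj)` —: the inverse `ϑ` and the image windows `T` by their Lusin–Souslin theorem, the density `jd` with `hlaw` by kernel Radon–Nikodym at the tree's absolute continuity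
of the (0.4) one-variable laws (`emlFibreLaw_fin`, every `N ≥ 1`).  So on the private-coordinate road EVERY a.e. face — N11's (B4) socket `hpush` ∕ `hfib` at `fieldMeasure`, def-T's
`transportOfRecord` ∕ (†) in the chart (file 1, n08-w2's p622706), the inner socket of the separated transport (files 3a–3c) — is discharged MODULO ONLY: blind jointly-measurable
INJECTIVITY WINDOWS of the one-variable maps `g ↦ Ū′(c)` (dag-n09-w6's `EMLFibreMapInjective` ✓ + `…N09CentralWindowInjective` ∕ `…N09CentralWindowAtRecord`: the central α-window,
`α ≤ 1/24`, `α < δ_N`, `offCard c/|Idx| + 150α < 1`) and the SUPPORT CLAUSE.  (N09's continuity clause `hgc` is NOT served by an `L¹` Radon–Nikodym Jacobian — (F) stays wanted there.)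

WHAT THIS FILE PROVES (0 `def`, 0 `sorry`, standard axioms; `k < K`).
§1 ★★★ `exists_perBondCharts_of_injectivityWindows_ac` — from `(Ω; hΩm, hinj)`: ∃ `(T, ϑ, jd)` with `hTm`, `hθm`, `hjm`, `hright`, `hlaw`, `T = image`, `hleft`, `ϑ ∈ Ω` (the ten
conjuncts of dag-n09-w6's INTENT-5, verbatim shapes, minus its four law hypotheses).
§2 ★★★ `exists_chart_transportOfRecord_ae_eq_of_injectivityWindows` — from BLIND injectivity windows `(Ω; hΩm, hΩbl, hinj)` alone: ∃ `(T, ϑ, jd)` such that dag-n11-d's `hpush` ∕ `hfib`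
hold at `(fieldMeasure (k+1), Kernel.const _ (fieldMeasure k))` on the charted set `{U | ∀ c, U(β c) ∈ Ω_c(U)}` AND for every `dU`-integrable measurable `ρ` with the support clause
`transportOfRecord F N K k ρ =ᵐ[dV] V ↦ ∫ dU 𝟙·∏ jd · ρ(extend β (ϑ_c(U, V c))_c U)` (file 1 ★★★ + file 2 ★★★ + §1).

HONEST FRAMING.  Helper lane of K1⁷; count-neutral; composition BY NAME ([Kechris1995] Lusin–Souslin via dag-n09-w6's file; Mathlib kernel Radon–Nikodym via file 2; p616307 via
file 1).  The injectivity windows `(Ω; hΩm, hΩbl, hinj)` remain HYPOTHESES here (dag-n09-w6's central α-window files discharge them at the record); the support clause is displayed;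
the Jacobian is a Radon–Nikodym VERSION; NO chart of Bałaban's ((47), [III] (3.10)–(3.25)) asserted — a valid chart of the disintegration, not print's; (B4) ∕ (S-α) NOT closed;
N11 NOT discharged; N09's `hgc` untouched; K1⁷ ∕ K1⁸ NOT closed, no registered stub touched; counts unmoved (typed 28∕28 · discharged 5∕27 · A 5∕28).  No summit statement is proved
by this seat.  One finite `𝕋⁴_{L^K}` programme at fixed `ε = L^{−K}`; R4 closes only the conditional finite-𝕋⁴ rung `BalabanLadder.UV` — NOT ℝ⁴, NOT OS, NOT a mass gap, NOT Clay.
No `sorry`, `axiom`, `def`, `instance`, `notation`.  Sources (SHAPE ∕ bookkeeping only): [I] (0.4) p.253, (2.9) p.266, (2.10) p.267; [III] (3.1) p.264, p.267 L18–24; [Kechris1995] Thm 15.1.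
-/

noncomputable section

open MeasureTheory ProbabilityTheory Set Function
open scoped ENNReal NNReal

namespace Summit.QuantumFields.YangMills.Theorems.BalabanUVNodesN11PerBondChartsOfInjectivityWindowsAC

open Literature.MathematicalPhysics.QuantumFieldTheory.Balaban1983to89
open Literature.MathematicalPhysics.QuantumFieldTheory.Balaban1983to89.T4AveragingDisintegration
open Literature.MathematicalPhysics.QuantumFieldTheory.Balaban1983to89.BlockAveragingHaarAC (centralBond centralBond_injective isLocal_avgFun)
open Literature.MeasureTheory.Function (exists_measurable_fibrewiseInverse)
open Summit.QuantumFields.YangMills.Theorems.BalabanUVNodesN11TransportOfRecordInPrivateCoordinateChart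
open Summit.QuantumFields.YangMills.Theorems.BalabanUVNodesN11PerBondInverseLawsOfRecordAC
open Node00 hiding SU
open T4Continuum

variable {F : T4Family} {N : ℕ} [NeZero N] {K k : ℕ}

/-! ## §1  The complete per-bond bundle from injectivity windows alone -/

/-- **★★★ PER-BOND INVERSION DATA OF THE AVERAGING OF RECORD FROM INJECTIVITY WINDOWS ALONE.**  At step `k < K`, given per coarse bond `c` a jointly measurable window
`Ω_c(U) ⊆ SU(N)` (`hΩm`) on which the one-variable map `g ↦ Ū′(c)`, `U′ = U[β(c) ↦ g]`, of `avOfRecord F N K k` is INJECTIVE (`hinj`) — and NOTHING ELSE —, there are jointly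
measurable coarse windows `T_c(U)` (= the images), inverses `ϑ_c(U,·)` (two-sided on `Ω_c(U)` ∕ `T_c(U)`, values in `Ω_c(U)`) and densities `jd_c(U,·) ≥ 0` with the inverse change-of-variables
law `dg⌊Ω_c(U) = ϑ_c(U,·)_*(jd_c(U,·) · dv⌊T_c(U))` — exactly the per-bond bundle consumed by `T4TriangularFibredChart` ∕ this seat's files 1–3.  The inverse is dag-n09-w6's Lusin–Souslin
fibrewise inverse; the law is file 2's kernel Radon–Nikodym density at the tree's absolute continuity (`emlFibreLaw_fin`).
[cite: Balaban1987RG1, (0.4) p.253, (2.9) p.266 and (2.10) p.267; Kechris1995, Thm 15.1] -/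
theorem exists_perBondCharts_of_injectivityWindows_ac [DecidableEq (PBond (F.P K) k)] (hk : k < K)
    (Ω : PBond (F.P K) (k + 1) → GaugeField (F.P K) k (SU N) → Set (SU N))
    (hΩm : ∀ c, MeasurableSet {p : GaugeField (F.P K) k (SU N) × SU N | p.2 ∈ Ω c p.1})
    (hinj : ∀ c U, InjOn (fun g => (avOfRecord F N K k).avg (update U (centralBond c) g) c) (Ω c U)) :
    ∃ (T : PBond (F.P K) (k + 1) → GaugeField (F.P K) k (SU N) → Set (SU N))
      (ϑ : PBond (F.P K) (k + 1) → GaugeField (F.P K) k (SU N) → SU N → SU N)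
      (jd : PBond (F.P K) (k + 1) → GaugeField (F.P K) k (SU N) → SU N → ℝ≥0),
      (∀ c, MeasurableSet {p : GaugeField (F.P K) k (SU N) × SU N | p.2 ∈ T c p.1}) ∧
      (∀ c, Measurable fun p : GaugeField (F.P K) k (SU N) × SU N => ϑ c p.1 p.2) ∧
      (∀ c, Measurable fun p : GaugeField (F.P K) k (SU N) × SU N => jd c p.1 p.2) ∧
      (∀ c U, ∀ v ∈ T c U, (avOfRecord F N K k).avg (update U (centralBond c) (ϑ c U v)) c = v) ∧
      (∀ c U, (HaarData.haar : Measure (SU N)).restrict (Ω c U) =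
        (((HaarData.haar : Measure (SU N)).restrict (T c U)).withDensity fun v => (jd c U v : ℝ≥0∞)).map (ϑ c U)) ∧
      (∀ c U, T c U = (fun g => (avOfRecord F N K k).avg (update U (centralBond c) g) c) '' Ω c U) ∧
      (∀ c U, ∀ g ∈ Ω c U, ϑ c U ((avOfRecord F N K k).avg (update U (centralBond c) g) c) = g) ∧
      (∀ c U, ∀ v ∈ T c U, ϑ c U v ∈ Ω c U) := by
  -- the fibrewise measurable inverse, bond by bond (Lusin–Souslin)
  have hinv : ∀ c, MeasurableSet {p : GaugeField (F.P K) k (SU N) × SU N |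
        p.2 ∈ (fun g => (avOfRecord F N K k).avg (update p.1 (centralBond c) g) c) '' Ω c p.1} ∧
      ∃ θ : GaugeField (F.P K) k (SU N) × SU N → SU N, Measurable θ ∧
        (∀ U, ∀ g ∈ Ω c U, θ (U, (avOfRecord F N K k).avg (update U (centralBond c) g) c) = g) ∧
        ∀ U, ∀ v ∈ (fun g => (avOfRecord F N K k).avg (update U (centralBond c) g) c) '' Ω c U,
          (avOfRecord F N K k).avg (update U (centralBond c) (θ (U, v))) c = v ∧ θ (U, v) ∈ Ω c U := fun c =>
    exists_measurable_fibrewiseInverse (E := GaugeField (F.P K) k (SU N)) (G := SU N)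
      (Ψ := fun p : GaugeField (F.P K) k (SU N) × SU N => (avOfRecord F N K k).avg (update p.1 (centralBond c) p.2) c)
      (Ω := Ω c) (measurable_oneVariable_avOfRecord c) (hΩm c) (hinj c)
  choose hTm θ hθm hleft hright using hinv
  -- the inverse laws by kernel Radon–Nikodym (file 2)
  obtain ⟨jd, hjm, hlaw⟩ := exists_perBondInverseLaws_of_inverses (F := F) (N := N) hk Ω
    (fun c U => (fun g => (avOfRecord F N K k).avg (update U (centralBond c) g) c) '' Ω c U) (fun c U v => θ c (U, v))
    hΩm hTm (fun c => hθm c) (fun c U g hg => mem_image_of_mem _ hg) (fun c U g hg => hleft c U g hg)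
  exact ⟨fun c U => (fun g => (avOfRecord F N K k).avg (update U (centralBond c) g) c) '' Ω c U, fun c U v => θ c (U, v), jd,
    hTm, fun c => hθm c, hjm, fun c U v hv => (hright c U v hv).1, hlaw, fun c U => rfl, fun c U g hg => hleft c U g hg,
    fun c U v hv => (hright c U v hv).2⟩

/-! ## §2  (B4)'s chart half at `fieldMeasure` modulo blind injectivity windows and the support clause only -/

/-- **★★★ THE FIBRE CHART OF THE AVERAGING OF RECORD AT `fieldMeasure` FROM BLIND INJECTIVITY WINDOWS ALONE.**  At step `k < K`, given per coarse bond `c` a jointly measurable window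
`Ω_c(U)`, BLIND to the private coordinates of the environment (`hΩbl`), on which `g ↦ Ū′(c)` is injective (`hinj`): THERE ARE `(T, ϑ, jd)` — coarse windows, jointly measurable inverses,
jointly measurable densities — such that with `Ψ (V,U) = extend β (c ↦ ϑ_c(U, V c)) U`, `J (V,U) = 𝟙[∀ c, V c ∈ T_c(U)]·∏_c jd_c(U, V c)`: (i) dag-n11-d's `hpush` at `(dV, Kernel.const _ dU)`
with charted set `{U | ∀ c, U(β c) ∈ Ω_c(U)}`; (ii) `hfib`; (iii) for every `dU`-integrable measurable density `ρ` with the support clause «`ρ U ≠ 0 ⇒ ∀ c, U(β c) ∈ Ω_c(U)`»,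
`transportOfRecord F N K k ρ =ᵐ[dV] V ↦ ∫ dU J(V,U)·ρ(Ψ(V,U))` — print's `∫dU δ(ŪV⁻¹)ρ(U)` ([I] (0.4), [III] (3.1)) as an honest resampled `dU`-integral, the δ-functions removed by
INVERTING `g ↦ Ū′(c)` on its window, bond by bond.  No Jacobian computed, no exponential chart, no background.
[cite: Balaban1988Convergent, (3.1) p.264, p.267 L18–24; Balaban1987RG1, (0.4) p.253, (2.9)–(2.10) pp.266–267; Kechris1995, Thm 15.1] -/
theorem exists_chart_transportOfRecord_ae_eq_of_injectivityWindows [DecidableEq (PBond (F.P K) k)] (hk : k < K)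
    (Ω : PBond (F.P K) (k + 1) → GaugeField (F.P K) k (SU N) → Set (SU N))
    (hΩm : ∀ c, MeasurableSet {p : GaugeField (F.P K) k (SU N) × SU N | p.2 ∈ Ω c p.1})
    (hΩbl : ∀ c (U : GaugeField (F.P K) k (SU N)) (g : PBond (F.P K) (k + 1) → SU N), Ω c (extend centralBond g U) = Ω c U)
    (hinj : ∀ c U, InjOn (fun g => (avOfRecord F N K k).avg (update U (centralBond c) g) c) (Ω c U)) :
    ∃ (T : PBond (F.P K) (k + 1) → GaugeField (F.P K) k (SU N) → Set (SU N))
      (ϑ : PBond (F.P K) (k + 1) → GaugeField (F.P K) k (SU N) → SU N → SU N)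
      (jd : PBond (F.P K) (k + 1) → GaugeField (F.P K) k (SU N) → SU N → ℝ≥0),
      (∀ c, MeasurableSet {p : GaugeField (F.P K) k (SU N) × SU N | p.2 ∈ T c p.1}) ∧
      (∀ c, Measurable fun p : GaugeField (F.P K) k (SU N) × SU N => ϑ c p.1 p.2) ∧
      (∀ c, Measurable fun p : GaugeField (F.P K) k (SU N) × SU N => jd c p.1 p.2) ∧
      (((fieldMeasure (F.P K) (k + 1) (SU N)) ⊗ₘ
          (Kernel.const (GaugeField (F.P K) (k + 1) (SU N)) (fieldMeasure (F.P K) k (SU N)))).withDensity fun z =>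
            (({p : GaugeField (F.P K) (k + 1) (SU N) × GaugeField (F.P K) k (SU N) | ∀ c, p.1 c ∈ T c p.2}.indicator
              (fun p => ∏ c, jd c p.2 (p.1 c)) z : ℝ≥0) : ℝ≥0∞)).map
          (fun z : GaugeField (F.P K) (k + 1) (SU N) × GaugeField (F.P K) k (SU N) =>
            (extend centralBond (fun c => ϑ c z.2 (z.1 c)) z.2 : GaugeField (F.P K) k (SU N))) =
        (fieldMeasure (F.P K) k (SU N)).restrict {U | ∀ c, U (centralBond c) ∈ Ω c U} ∧
      (∀ᵐ z ∂(((fieldMeasure (F.P K) (k + 1) (SU N)) ⊗ₘ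
          (Kernel.const (GaugeField (F.P K) (k + 1) (SU N)) (fieldMeasure (F.P K) k (SU N)))).withDensity fun z =>
            (({p : GaugeField (F.P K) (k + 1) (SU N) × GaugeField (F.P K) k (SU N) | ∀ c, p.1 c ∈ T c p.2}.indicator
              (fun p => ∏ c, jd c p.2 (p.1 c)) z : ℝ≥0) : ℝ≥0∞)),
        (avOfRecord F N K k).avg (extend centralBond (fun c => ϑ c z.2 (z.1 c)) z.2 : GaugeField (F.P K) k (SU N)) = z.1) ∧
      (∀ {ρ : Density (F.P K) k (SU N)}, Measurable ρ → Integrable ρ (fieldMeasure (F.P K) k (SU N)) →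
        (∀ U, ρ U ≠ 0 → ∀ c, U (centralBond c) ∈ Ω c U) →
        transportOfRecord F N K k ρ =ᵐ[fieldMeasure (F.P K) (k + 1) (SU N)] fun V => ∫ U,
          (({p : GaugeField (F.P K) (k + 1) (SU N) × GaugeField (F.P K) k (SU N) | ∀ c, p.1 c ∈ T c p.2}.indicator
              (fun p => ∏ c, jd c p.2 (p.1 c)) (V, U) : ℝ≥0) : ℝ) *
            ρ (extend centralBond (fun c => ϑ c U (V c)) U : GaugeField (F.P K) k (SU N)) ∂(fieldMeasure (F.P K) k (SU N))) := by
  obtain ⟨T, ϑ, jd, hTm, hθm, hjm, hright, hlaw, -, -, -⟩ := exists_perBondCharts_of_injectivityWindows_ac (F := F) (N := N) hk Ω hΩm hinj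
  exact ⟨T, ϑ, jd, hTm, hθm, hjm, hpush_privateChart Ω T ϑ jd hk hΩm hTm hθm hjm hΩbl hright hlaw,
    hfib_privateChart T ϑ jd hk hTm hjm hright _,
    fun hρm hρ hS => transportOfRecord_ae_eq_integral_privateChart_of_support Ω T ϑ jd hk hΩm hTm hθm hjm hΩbl hright hlaw hρm hρ hS⟩

end Summit.QuantumFields.YangMills.Theorems.BalabanUVNodesN11PerBondChartsOfInjectivityWindowsAC

end
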